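import Mathlib
import Literature.Analysis.FluidPDE.VectorCalculus
import Literature.Analysis.FluidPDE.WholeSpaceIBP

/-!
# The shell estimate for the momentum-flux error (plateau test)

Helper file of the stub `landauTail_shell_flux_estimate` (W3) of the crux `LandauTail.LandauTailBlowup`
(stmt-NavierStokesRegularity-1944, line registered). Pure real analysis. For a field `W : ℝ³ → ℝ³` and a
test field `φ` put `F(W) := ∫ (⟪W, (W·∇)φ⟫ + ⟪W, Δφ⟫)`. If `φ ∈ C²` is a PLATEAU test
(`tsupport φ ⊆ B_ρ`, `Dφ = 0` and `Δφ = 0` on the closed half-ball `B̄_{ρ/2}`, `‖Dφ‖ ≤ K/ρ`,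
`‖Δφ‖ ≤ K/ρ²`), `V ∈ C¹` and `U` is continuous off the origin with the envelope `‖U x‖ ≤ L/‖x‖`, then
with `w := V − U` and the shell `S := B_ρ ∖ B̄_{ρ/2}`

  `|F(V) − F(U)| ≤ (K/ρ²)(1 + 4L) ∫_S ‖w‖ + (K/ρ) ∫_S ‖w‖²`.

Proof: pointwise `Φ(V) − Φ(U) = ⟪w, Δφ⟫ + ⟪w, Dφ U⟫ + ⟪U, Dφ w⟫ + ⟪w, Dφ w⟫` (bilinearity); every
term vanishes off `S` (plateau inside, support outside), and on `S` one has `‖U‖ ≤ 2L/ρ`; integrate.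

* `landauTail_shellFlux_abs_sub_le` — the pointwise split/bound;
* `landauTail_shellFlux_integrableOn` — the flux integrand of a field continuous on a compact set is
  integrable on any subset;
* `landauTail_shell_flux_estimate` — the registered stub.
-/

set_option linter.dupNamespace false

noncomputable section

open MeasureTheory Set Metric Literature.Analysis.FluidPDE
open scoped InnerProductSpace RealInnerProductSpace Laplacian

namespace Summit.NavierStokesRegularity.NavierStokesRegularity.Theorems

section Pointwise

variable {F : Type*} [NormedAddCommGroup F] [InnerProductSpace ℝ F]

/-- **Pointwise split of the flux integrand.** With `‖D‖ ≤ M₁`, `‖L‖ ≤ M₂`, `‖b‖ ≤ B`, the integrand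
`Φ(a) = ⟪a, D a⟫ + ⟪a, L⟫` satisfies `|Φ(a) − Φ(b)| ≤ (M₂ + 2 M₁ B) ‖a − b‖ + M₁ ‖a − b‖²`
(`Φ(a) − Φ(b) = ⟪a−b, L⟫ + ⟪a−b, D b⟫ + ⟪b, D(a−b)⟫ + ⟪a−b, D(a−b)⟫`). [folklore] -/
theorem landauTail_shellFlux_abs_sub_le {a b L : F} {D : F →L[ℝ] F} {M₁ M₂ B : ℝ}
    (hD : ‖D‖ ≤ M₁) (hL : ‖L‖ ≤ M₂) (hb : ‖b‖ ≤ B) :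
    |(⟪a, D a⟫ + ⟪a, L⟫) - (⟪b, D b⟫ + ⟪b, L⟫)| ≤
      (M₂ + 2 * M₁ * B) * ‖a - b‖ + M₁ * ‖a - b‖ ^ 2 := by
  have hM₁ : 0 ≤ M₁ := (norm_nonneg _).trans hD
  have key : (⟪a, D a⟫ + ⟪a, L⟫) - (⟪b, D b⟫ + ⟪b, L⟫) =
      ⟪a - b, L⟫ + ⟪a - b, D b⟫ + ⟪b, D (a - b)⟫ + ⟪a - b, D (a - b)⟫ := by
    simp only [inner_sub_left, map_sub, inner_sub_right]
    ring
  rw [key]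
  have e1 : |⟪a - b, L⟫| ≤ ‖a - b‖ * M₂ :=
    (abs_real_inner_le_norm _ _).trans (mul_le_mul_of_nonneg_left hL (norm_nonneg _))
  have e2 : |⟪a - b, D b⟫| ≤ ‖a - b‖ * (M₁ * B) := by
    refine (abs_real_inner_le_norm _ _).trans (mul_le_mul_of_nonneg_left ?_ (norm_nonneg _))
    exact (D.le_opNorm b).trans (mul_le_mul hD hb (norm_nonneg _) hM₁)
  have e3 : |⟪b, D (a - b)⟫| ≤ B * (M₁ * ‖a - b‖) := by
    refine (abs_real_inner_le_norm _ _).trans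
      (mul_le_mul hb ?_ (norm_nonneg _) ((norm_nonneg _).trans hb))
    exact (D.le_opNorm _).trans (mul_le_mul_of_nonneg_right hD (norm_nonneg _))
  have e4 : |⟪a - b, D (a - b)⟫| ≤ ‖a - b‖ * (M₁ * ‖a - b‖) := by
    refine (abs_real_inner_le_norm _ _).trans (mul_le_mul_of_nonneg_left ?_ (norm_nonneg _))
    exact (D.le_opNorm _).trans (mul_le_mul_of_nonneg_right hD (norm_nonneg _))
  calc |⟪a - b, L⟫ + ⟪a - b, D b⟫ + ⟪b, D (a - b)⟫ + ⟪a - b, D (a - b)⟫|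
      ≤ |⟪a - b, L⟫| + |⟪a - b, D b⟫| + |⟪b, D (a - b)⟫| + |⟪a - b, D (a - b)⟫| := by
        refine (abs_add_le _ _).trans (add_le_add ?_ le_rfl)
        refine (abs_add_le _ _).trans (add_le_add ?_ le_rfl)
        exact abs_add_le _ _
    _ ≤ ‖a - b‖ * M₂ + ‖a - b‖ * (M₁ * B) + B * (M₁ * ‖a - b‖) + ‖a - b‖ * (M₁ * ‖a - b‖) :=
        add_le_add (add_le_add (add_le_add e1 e2) e3) e4
    _ = (M₂ + 2 * M₁ * B) * ‖a - b‖ + M₁ * ‖a - b‖ ^ 2 := by ring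

end Pointwise

/-- The flux integrand `x ↦ ⟪W x, (W·∇)φ x⟫ + ⟪W x, Δφ x⟫` of a field `W` continuous on a compact set
`T ⊆ ℝ³` against a `C²` test field `φ` is integrable on every `S ⊆ T`. [folklore] -/
theorem landauTail_shellFlux_integrableOn
    {W φ : EuclideanSpace ℝ (Fin 3) → EuclideanSpace ℝ (Fin 3)} {S T : Set (EuclideanSpace ℝ (Fin 3))}
    (hT : IsCompact T) (hST : S ⊆ T) (hW : ContinuousOn W T) (hφ : ContDiff ℝ 2 φ) :
    IntegrableOn (fun x => ⟪W x, convect W φ x⟫ + ⟪W x, Δ φ x⟫) S volume := by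
  refine IntegrableOn.mono_set (ContinuousOn.integrableOn_compact hT ?_) hST
  simp only [convect_apply]
  exact (hW.inner ((hφ.continuous_fderiv two_ne_zero).continuousOn.clm_apply hW)).add
    (hW.inner (continuous_laplacian hφ).continuousOn)

/-- **The shell estimate for the momentum-flux error.** For `V ∈ C¹(ℝ³; ℝ³)`, `U` continuous off the
origin with `‖U x‖ ≤ L/‖x‖`, and a `C²` plateau test `φ` (`tsupport φ ⊆ B_ρ`, `Dφ = Δφ = 0` on
`B̄_{ρ/2}`, `‖Dφ‖ ≤ K/ρ`, `‖Δφ‖ ≤ K/ρ²`), the fluxes `F(W) = ∫ (⟪W, (W·∇)φ⟫ + ⟪W, Δφ⟫)` satisfy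
`|F(V) − F(U)| ≤ (K/ρ²)(1 + 4L) ∫_S ‖V − U‖ + (K/ρ) ∫_S ‖V − U‖²` over the shell
`S = B_ρ ∖ B̄_{ρ/2}` (registered support stub W3 of crux stmt-NavierStokesRegularity-1944). [folklore] -/
theorem landauTail_shell_flux_estimate : ∀ (V U φ : EuclideanSpace ℝ (Fin 3) → EuclideanSpace ℝ (Fin 3)) (ρ K L : ℝ), 0 < ρ → 0 ≤ K → 0 ≤ L → ContDiff ℝ 1 V → ContinuousOn U {0}ᶜ → (∀ x : EuclideanSpace ℝ (Fin 3), x ≠ 0 → ‖U x‖ ≤ L / ‖x‖) → ContDiff ℝ 2 φ → tsupport φ ⊆ Metric.ball (0 : EuclideanSpace ℝ (Fin 3)) ρ → (∀ x ∈ Metric.closedBall (0 : EuclideanSpace ℝ (Fin 3)) (ρ / 2), fderiv ℝ φ x = 0) → (∀ x ∈ Metric.closedBall (0 : EuclideanSpace ℝ (Fin 3)) (ρ / 2), Laplacian.laplacian φ x = 0) → (∀ x, ‖fderiv ℝ φ x‖ ≤ K / ρ) → (∀ x, ‖Laplacian.laplacian φ x‖ ≤ K / ρ ^ 2) → |(∫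 x, (inner ℝ (V x) (Literature.Analysis.FluidPDE.convect V φ x) + inner ℝ (V x) (Laplacian.laplacian φ x))) - (∫ x, (inner ℝ (U x) (Literature.Analysis.FluidPDE.convect U φ x) + inner ℝ (U x) (Laplacian.laplacian φ x)))| ≤ K / ρ ^ 2 * (1 + 4 * L) * (∫ x in Metric.ball (0 : EuclideanSpace ℝ (Fin 3)) ρ \ Metric.closedBall (0 : EuclideanSpace ℝ (Fin 3)) (ρ / 2), ‖V x - U x‖) + K / ρ * (∫ x in Metric.ball (0 : EuclideanSpace ℝ (Fin 3)) ρ \ Metric.closedBall (0 : EuclideanSpace ℝ (Fin 3)) (ρ / 2), ‖V x - U x‖ ^ 2) := by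
  intro V U φ ρ K L hρ _hK hL hV hU hUL hφ hsupp hD0 hΔ0 hDK hΔK
  -- the shell `S` and the compact annulus `T ⊇ S` avoiding the origin
  set S : Set (EuclideanSpace ℝ (Fin 3)) := ball (0 : EuclideanSpace ℝ (Fin 3)) ρ \
    closedBall (0 : EuclideanSpace ℝ (Fin 3)) (ρ / 2) with hS
  set T : Set (EuclideanSpace ℝ (Fin 3)) := closedBall (0 : EuclideanSpace ℝ (Fin 3)) ρ \
    ball (0 : EuclideanSpace ℝ (Fin 3)) (ρ / 2) with hT
  have hST : S ⊆ T := sdiff_subset_sdiff ball_subset_closedBall ball_subset_closedBall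
  have hTc : IsCompact T := (isCompact_closedBall _ _).diff isOpen_ball
  have hSm : MeasurableSet S := measurableSet_ball.diff measurableSet_closedBall
  have hT0 : T ⊆ {0}ᶜ := by
    intro x hx h0
    rw [mem_singleton_iff] at h0
    exact hx.2 (by rw [h0]; exact mem_ball_self (half_pos hρ))
  -- `Dφ` and `Δφ` vanish off the shell
  have hoff : ∀ x, x ∉ S → fderiv ℝ φ x = 0 ∧ Δ φ x = 0 := by
    intro x hx
    by_cases hb : x ∈ closedBall (0 : EuclideanSpace ℝ (Fin 3)) (ρ / 2)
    · exact ⟨hD0 x hb, hΔ0 x hb⟩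
    · have hx' : x ∉ tsupport φ := fun h => hx ⟨hsupp h, hb⟩
      exact ⟨fderiv_of_notMem_tsupport ℝ hx', laplacian_eq_zero_of_notMem_tsupport hx'⟩
  have hzero : ∀ (W : EuclideanSpace ℝ (Fin 3) → EuclideanSpace ℝ (Fin 3)) (x), x ∉ S →
      ⟪W x, convect W φ x⟫ + ⟪W x, Δ φ x⟫ = 0 := by
    intro W x hx
    obtain ⟨h1, h2⟩ := hoff x hx
    simp [convect_apply, h1, h2]
  -- the envelope on the shell: `‖U x‖ ≤ 2L/ρ`
  have hUS : ∀ x ∈ S, ‖U x‖ ≤ 2 * L / ρ := by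
    intro x hx
    have hx2 : ρ / 2 < ‖x‖ := by
      have h := hx.2
      rwa [mem_closedBall_zero_iff, not_le] at h
    have hx0 : x ≠ 0 := by
      intro h
      rw [h, norm_zero] at hx2
      linarith
    calc ‖U x‖ ≤ L / ‖x‖ := hUL x hx0
      _ ≤ L / (ρ / 2) := div_le_div_of_nonneg_left hL (half_pos hρ) hx2.le
      _ = 2 * L / ρ := by rw [div_div_eq_mul_div, mul_comm]
  -- integrability
  have hVT : ContinuousOn V T := hV.continuous.continuousOn
  have hUT : ContinuousOn U T := hU.mono hT0
  have hfVi : IntegrableOn (fun x => ⟪V x, convect V φ x⟫ + ⟪V x, Δ φ x⟫) S volume :=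
    landauTail_shellFlux_integrableOn hTc hST hVT hφ
  have hfUi : IntegrableOn (fun x => ⟪U x, convect U φ x⟫ + ⟪U x, Δ φ x⟫) S volume :=
    landauTail_shellFlux_integrableOn hTc hST hUT hφ
  have hw : ContinuousOn (fun x => V x - U x) T := hVT.sub hUT
  have h1 : IntegrableOn (fun x => ‖V x - U x‖) S volume :=
    (hw.norm.integrableOn_compact hTc).mono_set hST
  have h2 : IntegrableOn (fun x => ‖V x - U x‖ ^ 2) S volume :=
    ((hw.norm.pow 2).integrableOn_compact hTc).mono_set hST
  -- pointwise bound on the shell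
  have hpt : ∀ x ∈ S, |(⟪V x, convect V φ x⟫ + ⟪V x, Δ φ x⟫) - (⟪U x, convect U φ x⟫ + ⟪U x, Δ φ x⟫)|
      ≤ K / ρ ^ 2 * (1 + 4 * L) * ‖V x - U x‖ + K / ρ * ‖V x - U x‖ ^ 2 := by
    intro x hx
    have h := landauTail_shellFlux_abs_sub_le (a := V x) (b := U x) (D := fderiv ℝ φ x)
      (L := Δ φ x) (hDK x) (hΔK x) (hUS x hx)
    have e : K / ρ ^ 2 + 2 * (K / ρ) * (2 * L / ρ) = K / ρ ^ 2 * (1 + 4 * L) := by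
      field_simp
      ring
    simpa only [convect_apply, e] using h
  -- integrate
  rw [← setIntegral_eq_integral_of_forall_compl_eq_zero (hzero V),
    ← setIntegral_eq_integral_of_forall_compl_eq_zero (hzero U), ← integral_sub hfVi hfUi]
  calc |∫ x in S, ((⟪V x, convect V φ x⟫ + ⟪V x, Δ φ x⟫) - (⟪U x, convect U φ x⟫ + ⟪U x, Δ φ x⟫))|
      ≤ ∫ x in S, |(⟪V x, convect V φ x⟫ + ⟪V x, Δ φ x⟫) - (⟪U x, convect U φ x⟫ + ⟪U x, Δ φ x⟫)| :=
        abs_integral_le_integral_abs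
    _ ≤ ∫ x in S, (K / ρ ^ 2 * (1 + 4 * L) * ‖V x - U x‖ + K / ρ * ‖V x - U x‖ ^ 2) :=
        setIntegral_mono_on (hfVi.sub hfUi).abs ((h1.const_mul _).fun_add (h2.const_mul _)) hSm hpt
    _ = K / ρ ^ 2 * (1 + 4 * L) * (∫ x in S, ‖V x - U x‖) + K / ρ * (∫ x in S, ‖V x - U x‖ ^ 2) := by
        rw [integral_add (h1.const_mul _) (h2.const_mul _), integral_const_mul, integral_const_mul]

end Summit.NavierStokesRegularity.NavierStokesRegularity.Theorems

end
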